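import Mathlib
import HarnessLib

/-!
# Points of a rectilinear set are flat, except finitely many

Topic `Literature/Probability/LatticeModels` (planar geometry glue for the tree facts
`ChelkakSmirnov2011_boundaryNormalisedPoissonKernelLimit` / `Kenyon2000_flatEdgePoissonKernelLimit`
of `FlatBoundaryPoissonKernelLimit.lean`, whose domains are "rectilinear": the frontier lies in a
finite union of axis-parallel segments, and whose distinguished boundary points are "flat": the
frontier near them lies on one horizontal or one vertical line). The boundary-value step of the
proof of Chelkak–Smirnov's Thm. 3.13 ("`H = 0` on `∂Ω ∖ {a}`") is run at every flat boundary
point; this file shows that all but finitely many frontier points are flat: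

* `rectCorners S` — for a finite set `S` of pairs (segment endpoints): all endpoints together with
  all points `(Re q'.1, Im q.1)`, `q, q' ∈ S` (a finite superset of the crossings of a horizontal
  with a vertical segment);
* `infDist_segment_pos` — a point off a (compact) segment is at positive distance from it;
* **`flat_of_not_mem_rectCorners`** — if `F ⊆ ⋃_{q ∈ S} [q.1, q.2]` with every pair axis-parallel,
  then every `ζ ∈ F ∖ rectCorners S` is flat: for some `r > 0`, either all points of `F` within `r`
  of `ζ` have `Im = Im ζ`, or all have `Re = Re ζ` (the segments missing `ζ` are compact, hence at
  positive distance; the segments through `ζ` are all parallel, since a horizontal and a vertical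
  one would cross at `ζ`).

Everything is proved, [folklore].
-/

noncomputable section

namespace Literature.Probability.LatticeModels

open Set Metric

/-- The finite exceptional set of a finite family of axis-parallel segments: endpoints and the
candidate crossing points `(Re q'.1, Im q.1)`. [folklore] -/
def rectCorners (S : Finset (ℂ × ℂ)) : Finset ℂ :=
  S.image Prod.fst ∪ S.image Prod.snd ∪ (S ×ˢ S).image fun p => (⟨p.2.1.re, p.1.1.im⟩ : ℂ)

/-- Endpoints are corners. [folklore] -/
theorem fst_mem_rectCorners {S : Finset (ℂ × ℂ)} {q : ℂ × ℂ} (hq : q ∈ S) : q.1 ∈ rectCorners S := by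
  unfold rectCorners
  exact Finset.mem_union_left _ (Finset.mem_union_left _ (Finset.mem_image_of_mem _ hq))

/-- Endpoints are corners. [folklore] -/
theorem snd_mem_rectCorners {S : Finset (ℂ × ℂ)} {q : ℂ × ℂ} (hq : q ∈ S) : q.2 ∈ rectCorners S := by
  unfold rectCorners
  exact Finset.mem_union_left _ (Finset.mem_union_right _ (Finset.mem_image_of_mem _ hq))

/-- Candidate crossings are corners. [folklore] -/
theorem cross_mem_rectCorners {S : Finset (ℂ × ℂ)} {q q' : ℂ × ℂ} (hq : q ∈ S) (hq' : q' ∈ S) :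
    (⟨q'.1.re, q.1.im⟩ : ℂ) ∈ rectCorners S := by
  unfold rectCorners
  refine Finset.mem_union_right _ (Finset.mem_image.2 ⟨(q, q'), Finset.mem_product.2 ⟨hq, hq'⟩, rfl⟩)

/-- A point off a segment is at positive distance from it (segments are compact, cf.
`Literature.Probability.Percolation.isCompact_segment_complex`). [folklore] -/
theorem infDist_segment_pos {a b ζ : ℂ} (h : ζ ∉ segment ℝ a b) : 0 < infDist ζ (segment ℝ a b) := by
  have hc : IsCompact (segment ℝ a b) := by
    rw [segment_eq_image_lineMap]
    exact isCompact_Icc.image AffineMap.lineMap_continuous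
  exact (hc.isClosed.notMem_iff_infDist_pos ⟨a, left_mem_segment ℝ a b⟩).1 h

/-- **All but finitely many points of a rectilinear set are flat.** Let `F ⊆ ⋃_{q ∈ S} [q.1, q.2]`
with every pair `q ∈ S` axis-parallel (`Re q.1 = Re q.2` or `Im q.1 = Im q.2`). Then every
`ζ ∈ F ∖ rectCorners S` has a neighbourhood in which `F` lies on the horizontal line through `ζ`, or
one in which `F` lies on the vertical line through `ζ`. [folklore] -/
theorem flat_of_not_mem_rectCorners {S : Finset (ℂ × ℂ)}
    (hS : ∀ q ∈ S, q.1.re = q.2.re ∨ q.1.im = q.2.im) {F : Set ℂ}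
    (hF : F ⊆ ⋃ q ∈ S, segment ℝ q.1 q.2) {ζ : ℂ} (hζF : ζ ∈ F) (hζ : ζ ∉ rectCorners S) :
    ∃ r : ℝ, 0 < r ∧ ((∀ z ∈ F, dist z ζ < r → z.im = ζ.im) ∨ (∀ z ∈ F, dist z ζ < r → z.re = ζ.re)) := by
  classical
  -- axis-parallel segments lie on their line
  -- (cf. `Literature.Probability.RandomPlanarGeometry.im_eq_of_mem_segment` in `FlatHulls.lean`,
  -- not imported here to keep this glue file light)
  have him_seg : ∀ {a b z : ℂ}, a.im = b.im → z ∈ segment ℝ a b → z.im = a.im := by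
    intro a b z hab hz
    obtain ⟨s, t, -, -, hst, rfl⟩ := hz
    simp only [Complex.add_im, Complex.smul_im, smul_eq_mul]
    rw [← hab, ← add_mul, hst, one_mul]
  have hre_seg : ∀ {a b z : ℂ}, a.re = b.re → z ∈ segment ℝ a b → z.re = a.re := by
    intro a b z hab hz
    obtain ⟨s, t, -, -, hst, rfl⟩ := hz
    simp only [Complex.add_re, Complex.smul_re, smul_eq_mul]
    rw [← hab, ← add_mul, hst, one_mul]
  -- the segments missing `ζ` are at positive distance
  set S' := S.filter fun q => ζ ∉ segment ℝ q.1 q.2 with hS'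
  obtain ⟨r, hr0, hr⟩ : ∃ r : ℝ, 0 < r ∧ ∀ q ∈ S', r ≤ infDist ζ (segment ℝ q.1 q.2) := by
    by_cases hne : S'.Nonempty
    · refine ⟨S'.inf' hne fun q => infDist ζ (segment ℝ q.1 q.2), ?_, fun q hq => Finset.inf'_le _ hq⟩
      rw [Finset.lt_inf'_iff]
      intro q hq
      exact infDist_segment_pos (Finset.mem_filter.1 hq).2
    · exact ⟨1, one_pos, fun q hq => absurd ⟨q, hq⟩ hne⟩
  -- a segment of `S` meeting the `r`-ball about `ζ` passes through `ζ`
  have hthrough : ∀ q ∈ S, ∀ z ∈ segment ℝ q.1 q.2, dist z ζ < r → ζ ∈ segment ℝ q.1 q.2 := by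
    intro q hq z hz hzr
    by_contra hζq
    have hq' : q ∈ S' := Finset.mem_filter.2 ⟨hq, hζq⟩
    have h1 := hr q hq'
    have h2 : infDist ζ (segment ℝ q.1 q.2) ≤ dist ζ z := infDist_le_dist_of_mem hz
    rw [dist_comm] at h2
    linarith
  -- the segments through `ζ` are nondegenerate and all parallel
  have hnotboth : ∀ q ∈ S, ζ ∈ segment ℝ q.1 q.2 → ∀ q' ∈ S, ζ ∈ segment ℝ q'.1 q'.2 →
      ¬ (q.1.im = q.2.im ∧ q'.1.re = q'.2.re) := by
    intro q hq hζq q' hq' hζq' ⟨hh, hv⟩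
    have him : ζ.im = q.1.im := him_seg hh hζq
    have hre : ζ.re = q'.1.re := hre_seg hv hζq'
    apply hζ
    have : ζ = (⟨q'.1.re, q.1.im⟩ : ℂ) := Complex.ext hre him
    rw [this]
    exact cross_mem_rectCorners hq hq'
  -- `ζ` lies on some segment `q₀`
  obtain ⟨q₀, hq₀, hζq₀⟩ : ∃ q₀ ∈ S, ζ ∈ segment ℝ q₀.1 q₀.2 := by
    have := hF hζF
    simp only [mem_iUnion] at this
    obtain ⟨q, hq, h⟩ := this
    exact ⟨q, hq, h⟩
  refine ⟨r, hr0, ?_⟩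
  rcases hS q₀ hq₀ with hv₀ | hh₀
  · -- `q₀` vertical: every segment through `ζ` is vertical
    right
    intro z hzF hzr
    obtain ⟨q, hq, hzq⟩ : ∃ q ∈ S, z ∈ segment ℝ q.1 q.2 := by
      have := hF hzF
      simp only [mem_iUnion] at this
      obtain ⟨q, hq, h⟩ := this
      exact ⟨q, hq, h⟩
    have hζq := hthrough q hq z hzq hzr
    rcases hS q hq with hv | hh
    · rw [hre_seg hv hzq, ← hre_seg hv hζq]
    · exact absurd ⟨hh, hv₀⟩ (hnotboth q hq hζq q₀ hq₀ hζq₀)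
  · -- `q₀` horizontal: every segment through `ζ` is horizontal
    left
    intro z hzF hzr
    obtain ⟨q, hq, hzq⟩ : ∃ q ∈ S, z ∈ segment ℝ q.1 q.2 := by
      have := hF hzF
      simp only [mem_iUnion] at this
      obtain ⟨q, hq, h⟩ := this
      exact ⟨q, hq, h⟩
    have hζq := hthrough q hq z hzq hzr
    rcases hS q hq with hv | hh
    · exact absurd ⟨hh₀, hv⟩ (hnotboth q₀ hq₀ hζq₀ q hq hζq)
    · rw [him_seg hh hzq, ← him_seg hh hζq]

end Literature.Probability.LatticeModels
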